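import Literature.Claims.NS.Mitrovic2024
import Literature.Analysis.FluidPDE.KatoMaximalTime
import Literature.Analysis.FluidPDE.KatoFarFieldBound
import Literature.Analysis.FluidPDE.KatoL3Uniqueness
import Literature.Analysis.FluidPDE.KatoLocalHolds
import Literature.Analysis.FluidPDE.NSKatoToClayHolds
import Literature.Analysis.FluidPDE.RusinSverakLeraySolutions
import Literature.Analysis.FluidPDE.NSLerayHopfSereginMild
import Literature.Analysis.FluidPDE.VectorCalculus
import HarnessLib

/-!
# Solo salvage for claim C74 `Mitrovic2024` (cell `ns-claims`, D-0090): Step 4 — a bounded global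
# Leray–Hopf solution from a `𝒟(ℝ³)` datum is a Clay-(A) solution — kernel-discharged

Claim skeleton: `Literature/Claims/NS/Mitrovic2024.lean` (typist-2); VERDICT (refuter-7, 2026-08-27):
false lemma at Step 2 `Gronwall2627` (kill `Theorems/SoloRefuteMitrovic2024.lean`). This file (seat
`ns-claims-salvage-p2`, salvage lane «by family») discharges Step 4, the one classical analytic step of
the chain (l.633–636: «Since `u` is bounded, it must be smooth and unique (see [rieusset, serrin])»):

* `step4_holds : BoundedLerayHopfSmooth` — a global Leray–Hopf solution (`ν = 1`, `f ≡ 0`) from a smooth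
  compactly supported divergence-free datum which is bounded on `[0,∞) × ℝ³` yields a Clay-sense solution
  for that datum. Proof (bookkeeping over PROVED tree engines, the pattern of
  `typeICertificateLadder_noBlowupToClay_proof`): Kato maximal-time dichotomy — if `T_max = ∞` the global
  Kato solution gives the Clay solution (`clay_solution_of_hasGlobalKatoSolution_holds`); if `T_max = T < ∞`
  the maximal Kato solution `w` has a singular point `(T, x₁)`
  (`lemarieRieusset_singular_point_of_blowup_holds`), while `w = u` a.e. on `(0,T) × ℝ³`
  (`IsGlobalLerayHopf.ae_eq_uncurry_of_isKatoSolutionOn`: weak–strong uniqueness through the Tao-class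
  solutions) and `u` is bounded — contradiction (`eLpNorm_parabolicCylinder_eq_top_of_ae_eq`).
  Classical content: Serrin 1962 / Prodi 1959 (the `L^∞_tL^∞_x` class), Lemarié-Rieusset 2016 Thm 15.1.

Solo lane (`Theorems/SoloSalvage<Slug>.lean`, no item).

WHAT THIS IS NOT: not a claim about NS regularity or blow-up; not a claim about any author beyond the
typed locator.
-/

noncomputable section

open Literature.Analysis.FluidPDE MeasureTheory Set Function Filter Topology Metric
open scoped ENNReal NNReal

-- The mandated landing namespace repeats the summit name by design (D-0017).
set_option linter.dupNamespace false

namespace Summit.NavierStokesRegularity.NavierStokesRegularity.Theorems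

namespace Mitrovic2024

open Literature.Claims.NS.Mitrovic2024 Literature.Claims.NS.ClayVariants

/-- **Step 4 HOLDS** (l.633–636 p.9: «Since `u` is bounded, it must be smooth and unique (see [rieusset,
serrin])»; Serrin's class `L^∞_tL^∞_x`): a global Leray–Hopf solution of the unforced system (`ν = 1`) from
a `𝒟(ℝ³)` datum which is bounded on `[0,∞) × ℝ³` gives a Clay-(A)-sense solution for that datum — Kato
maximal-time dichotomy, the singular point at a finite maximal time (Lemarié-Rieusset 2016 Thm 15.1 (C)),
and weak–strong uniqueness, all proved in the tree. [cite: Mitrovic2024, l.633–636 p.9] -/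
theorem step4_holds : Literature.Claims.NS.Mitrovic2024.BoundedLerayHopfSmooth := by
  intro u₀ hu₀ u hLH hbd
  obtain ⟨hsm, hac, hdiv⟩ := hu₀
  obtain ⟨M, hM⟩ := hbd
  classical
  have hν : (0 : ℝ) < 1 := one_pos
  have hdec : HasRapidSpatialDecay u₀ := HasRapidSpatialDecay.of_hasCompactSupport hsm hac
  have hdiv' : VectorCalculus.IsDivFree u₀ := fun x => hdiv x
  -- the datum: `L³`, weakly divergence free
  have hmeas0 : AEStronglyMeasurable u₀ volume := hsm.continuous.aestronglyMeasurable
  have hu3 : MemLp u₀ 3 volume := hsm.continuous.memLp_of_hasCompactSupport hac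
  have hwdiv : IsWeaklyDivFree u₀ :=
    VectorCalculus.IsDivFree.isWeaklyDivFree_holds hdiv' (hsm.of_le (mod_cast le_top))
  -- the Kato maximal time
  by_cases htop : katoMaximalTime 1 u₀ = ⊤
  · -- global Kato solution: the Clay solution
    exact clay_solution_of_hasGlobalKatoSolution_holds 1 hν u₀ hsm hdiv hdec
      (hasGlobalKatoSolution_of_katoMaximalTime_eq_top kato_unique_holds hν htop)
  exfalso
  have hTm0 : 0 < katoMaximalTime 1 u₀ := katoMaximalTime_pos kato_local_holds hν hu3 hwdiv
  have htop' : katoMaximalTime 1 u₀ < ⊤ := lt_top_iff_ne_top.2 htop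
  obtain ⟨w, hw⟩ := exists_isKatoSolutionOn_katoMaximalTime kato_unique_holds hν hTm0 htop'
  set T : ℝ := (katoMaximalTime 1 u₀).toReal with hT_def
  have hT0 : 0 < T := ENNReal.toReal_pos hTm0.ne' htop'.ne
  have hofReal : ENNReal.ofReal T = katoMaximalTime 1 u₀ := ENNReal.ofReal_toReal htop'.ne
  have hmax : ∀ T'' : ℝ, T < T'' → ∀ w' : ℝ → EuclideanSpace ℝ (Fin 3) → EuclideanSpace ℝ (Fin 3),
      ¬ IsKatoSolutionOn T'' 1 u₀ w' :=
    fun T'' hT'' w' => not_isKatoSolutionOn_of_katoMaximalTime_lt (by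
      rw [← hofReal]
      exact (ENNReal.ofReal_lt_ofReal_iff (hT0.trans hT'')).2 hT'')
  -- its singular point `(T, x₁)`
  obtain ⟨x₁, hx₁⟩ := lemarieRieusset_singular_point_of_blowup_holds hν hT0 hu3 hwdiv hw hmax
  have hall : ∀ r : ℝ, 0 < r →
      eLpNorm (uncurry w) ⊤ (volume.restrict (parabolicCylinder r ((T : ℝ), x₁))) = ⊤ :=
    fun r hr => eLpNorm_top_parabolicCylinder_eq_top_of_small hT0 hx₁ hr
  -- the bounded Leray–Hopf solution agrees with `w` a.e. on the strip `(0,T) × ℝ³`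
  have hv : IsGlobalLerayHopf 1 0 u₀ u := hLH
  have hae : uncurry u =ᵐ[volume.restrict (Ioo 0 T ×ˢ (univ : Set (EuclideanSpace ℝ (Fin 3))))]
      uncurry w :=
    hv.ae_eq_uncurry_of_isKatoSolutionOn hν hsm hac hdiv' hT0 hw
  -- `u` is bounded on a small cylinder below `(T, x₁)` …
  set r : ℝ := min 1 (Real.sqrt (T / 2)) with hr_def
  have hr0 : 0 < r := lt_min one_pos (Real.sqrt_pos.2 (by positivity))
  have hr2 : r ^ 2 ≤ T / 2 := by
    calc r ^ 2 ≤ Real.sqrt (T / 2) ^ 2 := pow_le_pow_left₀ hr0.le (min_le_right _ _) 2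
      _ = T / 2 := Real.sq_sqrt (by positivity)
  have hbdU : eLpNorm (uncurry u) ⊤ (volume.restrict (parabolicCylinder r ((T : ℝ), x₁))) < ⊤ := by
    rw [eLpNorm_exponent_top]
    refine eLpNormEssSup_lt_top_of_ae_bound (C := M) ?_
    filter_upwards [ae_restrict_mem (isOpen_parabolicCylinder r ((T : ℝ), x₁)).measurableSet]
      with z hz
    obtain ⟨s, y⟩ := z
    rw [mem_parabolicCylinder] at hz
    have hs : 0 ≤ s := by linarith [hz.1.1, hr2]
    exact hM s hs y
  -- … while the singularity of `w` at `(T, x₁)` transfers to `u`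
  exact hbdU.ne (eLpNorm_parabolicCylinder_eq_top_of_ae_eq hT0 hae x₁ hall hr0)

/-- Bookkeeping: with Steps 3 (`rescale560_holds`, typist) and 4 (`step4_holds`) discharged, the kernel
composition `claim_of_steps` needs only `RouteExists` and the (refuted) `Gronwall2627`.
[cite: Mitrovic2024, Thm. 4 p.8] -/
theorem claim_of_steps_inputs (h1 : RouteExists) (h2 : Gronwall2627) :
    Literature.Claims.NS.Mitrovic2024.ClaimedTheorem :=
  claim_of_steps h1 h2 step4_holds

end Mitrovic2024

end Summit.NavierStokesRegularity.NavierStokesRegularity.Theorems
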